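import Summits.BirchSwinnertonDyer.BirchSwinnertonDyer.Theorems.KolyvaginDepthDoorDepthTableCruxClauseSecondSign
import Summits.BirchSwinnertonDyer.BirchSwinnertonDyer.Theorems.KolyvaginDepthDoorDepthTableRowsSecondSign5
import Summits.BirchSwinnertonDyer.BirchSwinnertonDyer.Theorems.KolyvaginDepthDoorDepthTableRowsSecondSign6
import HarnessLib

/-!
# Route `KolyvaginDepthDoor` — the crux `KolyvaginDepthSupply` AT EACH SECOND-SIGN CURVE is decided by
# one computation, WITHOUT Kolyvagin's structure theorem — part 3 (crux stmt-BirchSwinnertonDyer-21765)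

Helper file (`--supports stmt-BirchSwinnertonDyer-21765 --as helper`); it closes nothing and BSD is
not proved by it.

For each second-sign row `(E, p, d_K, ℓ)` of `…DepthTableRowsSecondSign1–6` (a rank-one curve `E`, a
Heegner field `K = ℚ(√d_K)` whose twist `E^{(d_K)}` has two independent rational points, kernel-certified),
the clause of the crux `KolyvaginDepthSupply` (`Theses/KolyvaginDepthDoor.lean`, verbatim —
`kolyvaginDepthSupply_iff_forall_clause` is `Iff.rfl`) instantiated at `E` follows from the bit
`c_1(ℓ) ≠ 0`, by the generic `kolyvaginDepthSupply_clause_secondSign_of_intModel_certificate`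
(`…DepthTableCruxClauseSecondSign`): witnesses `p`, `K` and the minimal non-zero class of the system,
whose depth is `1 = rank_ℤ E(ℚ)` because a non-zero class at depth `0` would be the class of a torsion
Heegner point (`rank_ℤ E(K) = 1 + 2` by `mordellWeilRank_baseChange_quadratic_holds` against Kolyvagin's
Theorem A). Named inputs: (γ) = `GrossLMS1991.prop37_2_frobeniusCongruence` and Kolyvagin's Theorem A
`kolyvagin (N_E) E K` — NOT the route's XL support item `KolyvaginStructure` (contrast g2's first-sign
`C<label>.kolyvaginDepthSupply_clause`, which needs it). HONEST FRAMING: the crux is a `∀ W` statement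
(class-wide = X1 on non-CM curves, g0's calibration p582259); these are more of its cheapest
instances, each one computation away, on the disjunct no earlier instance used. Nothing class-wide moves.

| curve | `p` | `d_K` | `ℓ` | theorem |
|---|---|---|---|---|
| `61a1` = `[1,0,0,-2,1]` | `7` | `-136` | `97` | `SecondSign.C61a1.kolyvaginDepthSupply_clause_secondSign_neg136` |
| `77a1` = `[0,0,1,2,0]` | `5` | `-68` | `29` | `SecondSign.C77a1.kolyvaginDepthSupply_clause_secondSign_neg68` |
| `77a1` = `[0,0,1,2,0]` | `5` | `-131` | `29` | `SecondSign.C77a1.kolyvaginDepthSupply_clause_secondSign_neg131` |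

References: [Kolyvagin1991MathAnn] Thm. 2.3, §2 Thm. 4; [Kolyvagin1990] Thm. A; [GrossLMS1991] Thm. 1.3,
Prop. 3.7 (2), §4, Prop. 4.7 (1); [WZhang2014] Notations (xii); [JetchevLauterStein2009] §3.6.
-/

set_option linter.dupNamespace false

noncomputable section

open scoped Classical NumberField

namespace Summit.BirchSwinnertonDyer.BirchSwinnertonDyer.Theorems.KolyvaginDepthDoor

open Literature.NumberTheory.EllipticCurves Literature.NumberTheory.EllipticCurves.ModularForms
  WeierstrassCurve
open Summit.BirchSwinnertonDyer.BirchSwinnertonDyer.Rank2Observatory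

namespace SecondSign

namespace C61a1

/-- **The crux `KolyvaginDepthSupply` RESTRICTED TO `61a1` is decided by one computation on the SECOND
sign — no Kolyvagin structure theorem.** For `E = 61a1` (rank one), any imaginary quadratic `K` with
`d_K = -136` (Heegner; `E^{(-136)}` has rank two, kernel-certified), any frame `(Dt, β, ι)` and any
Kolyvagin–Heegner datum `d` of conductor `97`, granted (γ) = `GrossLMS1991.prop37_2_frobeniusCongruence`
and Kolyvagin's Theorem A `kolyvagin (N_E) E K` (a non-torsion Heegner point gives `rank_ℤ E(K) = 1`):
`c_1(97) ≠ 0` ⇒ the clause of `KolyvaginDepthSupply` at `E`, VERBATIM (witnesses `p = 7`, this `K`, the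
minimal non-zero class of the system; the disjunct `ν = rank_ℤ E(ℚ) = 1 ∧ rank_ℤ E^{(d_K)}(ℚ) = 2`).
Side conditions all kernel theorems of `…RowsSecondSign5`. CONDITIONAL on (γ), Kolyvagin's Thm. A and
the bit; per-curve; BSD is not proved by it. [cite: Kolyvagin1991MathAnn, Thm. 2.3 and §2 Thm. 4]
[cite: Kolyvagin1990, Thm. A] [cite: GrossLMS1991, Thm. 1.3, Prop. 3.7 (2), §4] -/
theorem kolyvaginDepthSupply_clause_secondSign_neg136
    (h372 : GrossLMS1991.prop37_2_frobeniusCongruence)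
    (K : Type) [Field K] [NumberField K] (hK : IsImaginaryQuadratic K)
    (hD : NumberField.discr K = -136)
    (hKoly : haveI := isElliptic;
      haveI : NeZero (((⟨1, 0, 0, -2, 1⟩ : WeierstrassCurve ℤ).map (Int.castRingHom ℚ)).conductorNorm ℤ) := neZero_conductorNorm_of_isElliptic _;
      kolyvagin (((⟨1, 0, 0, -2, 1⟩ : WeierstrassCurve ℤ).map (Int.castRingHom ℚ)).conductorNorm ℤ) ((⟨1, 0, 0, -2, 1⟩ : WeierstrassCurve ℤ).map (Int.castRingHom ℚ)) K) :
    haveI := isElliptic;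
    haveI := isGloballyMinimal;
    haveI : NeZero (((⟨1, 0, 0, -2, 1⟩ : WeierstrassCurve ℤ).map (Int.castRingHom ℚ)).conductorNorm ℤ) := neZero_conductorNorm_of_isElliptic _;
    ∀ (Dt : ModularParametrizationData ((⟨1, 0, 0, -2, 1⟩ : WeierstrassCurve ℤ).map (Int.castRingHom ℚ)) (((⟨1, 0, 0, -2, 1⟩ : WeierstrassCurve ℤ).map (Int.castRingHom ℚ)).conductorNorm ℤ)) (β : ℤ) (ι : K →+* ℂ)
      (d : KolyvaginHeegnerData Dt β ι 97),
    d.kolyvaginClass (p := 7) (by norm_num) 1 ≠ 0 →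
    ∃ (p : ℕ) (hp : Fact p.Prime), 5 ≤ p ∧ ((⟨1, 0, 0, -2, 1⟩ : WeierstrassCurve ℤ).map (Int.castRingHom ℚ)).HasGoodReductionAtPrime p ∧ ¬ (p : ℤ) ∣
      ((⟨1, 0, 0, -2, 1⟩ : WeierstrassCurve ℤ).map (Int.castRingHom ℚ)).frobeniusTrace p ∧ ((⟨1, 0, 0, -2, 1⟩ : WeierstrassCurve ℤ).map (Int.castRingHom ℚ)).HasSurjectiveModNGaloisRep p ∧ ∃ (K : Type) (_ : Field K) (_ :
      NumberField K), Literature.NumberTheory.EllipticCurves.IsImaginaryQuadratic K ∧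
      NumberField.discr K ≠ -3 ∧ NumberField.discr K ≠ -4 ∧ ¬ ((p : ℤ) ∣ NumberField.discr K) ∧ ¬ (p
      ∣ ((⟨1, 0, 0, -2, 1⟩ : WeierstrassCurve ℤ).map (Int.castRingHom ℚ)).conductorNorm ℤ) ∧ ∃ (_ : NeZero (((⟨1, 0, 0, -2, 1⟩ : WeierstrassCurve ℤ).map (Int.castRingHom ℚ)).conductorNorm ℤ)),
      Literature.NumberTheory.EllipticCurves.SatisfiesHeegnerHypothesis (((⟨1, 0, 0, -2, 1⟩ : WeierstrassCurve ℤ).map (Int.castRingHom ℚ)).conductorNorm ℤ) K ∧ ∃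
      (Dt : Literature.NumberTheory.EllipticCurves.ModularForms.ModularParametrizationData ((⟨1, 0, 0, -2, 1⟩ : WeierstrassCurve ℤ).map (Int.castRingHom ℚ))
      (((⟨1, 0, 0, -2, 1⟩ : WeierstrassCurve ℤ).map (Int.castRingHom ℚ)).conductorNorm ℤ)) (β : ℤ) (ι : K →+* ℂ) (n : ℕ) (d :
      Literature.NumberTheory.EllipticCurves.KolyvaginHeegnerData Dt β ι n) (M : ℕ),
      Literature.NumberTheory.EllipticCurves.KolyvaginDescent.KolSupp
      (Literature.NumberTheory.EllipticCurves.Zhang2014.IsKolyvaginPrime (((⟨1, 0, 0, -2, 1⟩ : WeierstrassCurve ℤ).map (Int.castRingHom ℚ)).conductorNorm ℤ) ((⟨1, 0, 0, -2, 1⟩ : WeierstrassCurve ℤ).map (Int.castRingHom ℚ)) K p)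
      n ∧ 1 ≤ M ∧ (M : ℕ∞) ≤ Literature.NumberTheory.EllipticCurves.Zhang2014.levelIndex ((⟨1, 0, 0, -2, 1⟩ : WeierstrassCurve ℤ).map (Int.castRingHom ℚ)) p n ∧
      d.kolyvaginClass hp.out M ≠ 0 ∧ (∀ (n' : ℕ) (d' :
      Literature.NumberTheory.EllipticCurves.KolyvaginHeegnerData Dt β ι n') (M' : ℕ),
      Literature.NumberTheory.EllipticCurves.KolyvaginDescent.KolSupp
      (Literature.NumberTheory.EllipticCurves.Zhang2014.IsKolyvaginPrime (((⟨1, 0, 0, -2, 1⟩ : WeierstrassCurve ℤ).map (Int.castRingHom ℚ)).conductorNorm ℤ) ((⟨1, 0, 0, -2, 1⟩ : WeierstrassCurve ℤ).map (Int.castRingHom ℚ)) K p)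
      n' → 1 ≤ M' → (M' : ℕ∞) ≤ Literature.NumberTheory.EllipticCurves.Zhang2014.levelIndex ((⟨1, 0, 0, -2, 1⟩ : WeierstrassCurve ℤ).map (Int.castRingHom ℚ)) p n' →
      d'.kolyvaginClass hp.out M' ≠ 0 → n.primeFactors.card ≤ n'.primeFactors.card) ∧
      ((n.primeFactors.card + 1 = ((⟨1, 0, 0, -2, 1⟩ : WeierstrassCurve ℤ).map (Int.castRingHom ℚ)).mordellWeilRank ∧ (((⟨1, 0, 0, -2, 1⟩ : WeierstrassCurve ℤ).map (Int.castRingHom ℚ)).quadraticTwist (NumberField.discr K :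
      ℚ)).mordellWeilRank < ((⟨1, 0, 0, -2, 1⟩ : WeierstrassCurve ℤ).map (Int.castRingHom ℚ)).mordellWeilRank) ∨ (n.primeFactors.card = ((⟨1, 0, 0, -2, 1⟩ : WeierstrassCurve ℤ).map (Int.castRingHom ℚ)).mordellWeilRank ∧
      (((⟨1, 0, 0, -2, 1⟩ : WeierstrassCurve ℤ).map (Int.castRingHom ℚ)).quadraticTwist (NumberField.discr K : ℚ)).mordellWeilRank = ((⟨1, 0, 0, -2, 1⟩ : WeierstrassCurve ℤ).map (Int.castRingHom ℚ)).mordellWeilRank + 1)) := by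
  haveI := isElliptic
  haveI := isGloballyMinimal
  haveI : NeZero (((⟨1, 0, 0, -2, 1⟩ : WeierstrassCurve ℤ).map (Int.castRingHom ℚ)).conductorNorm ℤ) := neZero_conductorNorm_of_isElliptic _
  intro Dt β ι d hne
  haveI := Fact.mk (by norm_num : Nat.Prime 7)
  exact kolyvaginDepthSupply_clause_secondSign_of_intModel_certificate intModel h372 not_hasCM
    one_le_rank 7 (by norm_num) (by decide +kernel) (np := 7) card_7 (by decide +kernel)
    hasSurjectiveModNGaloisRep_pow_7 K hK hD (by norm_num) (by norm_num) (by norm_num)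
    twistModel_neg136 two_le_rank_twist_neg136 heegner_neg136 97 (by norm_num) (by norm_num)
    (by decide +kernel) (by norm_num) (by norm_num) (by norm_num) (by norm_num) (n := 112) card_97
    (by norm_num) (Δ₀ := -61) (by decide +kernel) (B := 11) (by decide +kernel) (by decide +kernel)
    (fun _ _ ↦ Or.inl (by norm_num)) hKoly Dt β ι d hne

end C61a1

namespace C77a1

/-- **The crux `KolyvaginDepthSupply` RESTRICTED TO `77a1` is decided by one computation on the SECOND
sign — no Kolyvagin structure theorem.** For `E = 77a1` (rank one), any imaginary quadratic `K` with
`d_K = -68` (Heegner; `E^{(-68)}` has rank two, kernel-certified), any frame `(Dt, β, ι)` and any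
Kolyvagin–Heegner datum `d` of conductor `29`, granted (γ) = `GrossLMS1991.prop37_2_frobeniusCongruence`
and Kolyvagin's Theorem A `kolyvagin (N_E) E K` (a non-torsion Heegner point gives `rank_ℤ E(K) = 1`):
`c_1(29) ≠ 0` ⇒ the clause of `KolyvaginDepthSupply` at `E`, VERBATIM (witnesses `p = 5`, this `K`, the
minimal non-zero class of the system; the disjunct `ν = rank_ℤ E(ℚ) = 1 ∧ rank_ℤ E^{(d_K)}(ℚ) = 2`).
Side conditions all kernel theorems of `…RowsSecondSign6`. CONDITIONAL on (γ), Kolyvagin's Thm. A and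
the bit; per-curve; BSD is not proved by it. [cite: Kolyvagin1991MathAnn, Thm. 2.3 and §2 Thm. 4]
[cite: Kolyvagin1990, Thm. A] [cite: GrossLMS1991, Thm. 1.3, Prop. 3.7 (2), §4] -/
theorem kolyvaginDepthSupply_clause_secondSign_neg68
    (h372 : GrossLMS1991.prop37_2_frobeniusCongruence)
    (K : Type) [Field K] [NumberField K] (hK : IsImaginaryQuadratic K)
    (hD : NumberField.discr K = -68)
    (hKoly : haveI := isElliptic;
      haveI : NeZero (((⟨0, 0, 1, 2, 0⟩ : WeierstrassCurve ℤ).map (Int.castRingHom ℚ)).conductorNorm ℤ) := neZero_conductorNorm_of_isElliptic _;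
      kolyvagin (((⟨0, 0, 1, 2, 0⟩ : WeierstrassCurve ℤ).map (Int.castRingHom ℚ)).conductorNorm ℤ) ((⟨0, 0, 1, 2, 0⟩ : WeierstrassCurve ℤ).map (Int.castRingHom ℚ)) K) :
    haveI := isElliptic;
    haveI := isGloballyMinimal;
    haveI : NeZero (((⟨0, 0, 1, 2, 0⟩ : WeierstrassCurve ℤ).map (Int.castRingHom ℚ)).conductorNorm ℤ) := neZero_conductorNorm_of_isElliptic _;
    ∀ (Dt : ModularParametrizationData ((⟨0, 0, 1, 2, 0⟩ : WeierstrassCurve ℤ).map (Int.castRingHom ℚ)) (((⟨0, 0, 1, 2, 0⟩ : WeierstrassCurve ℤ).map (Int.castRingHom ℚ)).conductorNorm ℤ)) (β : ℤ) (ι : K →+* ℂ)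
      (d : KolyvaginHeegnerData Dt β ι 29),
    d.kolyvaginClass (p := 5) (by norm_num) 1 ≠ 0 →
    ∃ (p : ℕ) (hp : Fact p.Prime), 5 ≤ p ∧ ((⟨0, 0, 1, 2, 0⟩ : WeierstrassCurve ℤ).map (Int.castRingHom ℚ)).HasGoodReductionAtPrime p ∧ ¬ (p : ℤ) ∣
      ((⟨0, 0, 1, 2, 0⟩ : WeierstrassCurve ℤ).map (Int.castRingHom ℚ)).frobeniusTrace p ∧ ((⟨0, 0, 1, 2, 0⟩ : WeierstrassCurve ℤ).map (Int.castRingHom ℚ)).HasSurjectiveModNGaloisRep p ∧ ∃ (K : Type) (_ : Field K) (_ :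
      NumberField K), Literature.NumberTheory.EllipticCurves.IsImaginaryQuadratic K ∧
      NumberField.discr K ≠ -3 ∧ NumberField.discr K ≠ -4 ∧ ¬ ((p : ℤ) ∣ NumberField.discr K) ∧ ¬ (p
      ∣ ((⟨0, 0, 1, 2, 0⟩ : WeierstrassCurve ℤ).map (Int.castRingHom ℚ)).conductorNorm ℤ) ∧ ∃ (_ : NeZero (((⟨0, 0, 1, 2, 0⟩ : WeierstrassCurve ℤ).map (Int.castRingHom ℚ)).conductorNorm ℤ)),
      Literature.NumberTheory.EllipticCurves.SatisfiesHeegnerHypothesis (((⟨0, 0, 1, 2, 0⟩ : WeierstrassCurve ℤ).map (Int.castRingHom ℚ)).conductorNorm ℤ) K ∧ ∃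
      (Dt : Literature.NumberTheory.EllipticCurves.ModularForms.ModularParametrizationData ((⟨0, 0, 1, 2, 0⟩ : WeierstrassCurve ℤ).map (Int.castRingHom ℚ))
      (((⟨0, 0, 1, 2, 0⟩ : WeierstrassCurve ℤ).map (Int.castRingHom ℚ)).conductorNorm ℤ)) (β : ℤ) (ι : K →+* ℂ) (n : ℕ) (d :
      Literature.NumberTheory.EllipticCurves.KolyvaginHeegnerData Dt β ι n) (M : ℕ),
      Literature.NumberTheory.EllipticCurves.KolyvaginDescent.KolSupp
      (Literature.NumberTheory.EllipticCurves.Zhang2014.IsKolyvaginPrime (((⟨0, 0, 1, 2, 0⟩ : WeierstrassCurve ℤ).map (Int.castRingHom ℚ)).conductorNorm ℤ) ((⟨0, 0, 1, 2, 0⟩ : WeierstrassCurve ℤ).map (Int.castRingHom ℚ)) K p)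
      n ∧ 1 ≤ M ∧ (M : ℕ∞) ≤ Literature.NumberTheory.EllipticCurves.Zhang2014.levelIndex ((⟨0, 0, 1, 2, 0⟩ : WeierstrassCurve ℤ).map (Int.castRingHom ℚ)) p n ∧
      d.kolyvaginClass hp.out M ≠ 0 ∧ (∀ (n' : ℕ) (d' :
      Literature.NumberTheory.EllipticCurves.KolyvaginHeegnerData Dt β ι n') (M' : ℕ),
      Literature.NumberTheory.EllipticCurves.KolyvaginDescent.KolSupp
      (Literature.NumberTheory.EllipticCurves.Zhang2014.IsKolyvaginPrime (((⟨0, 0, 1, 2, 0⟩ : WeierstrassCurve ℤ).map (Int.castRingHom ℚ)).conductorNorm ℤ) ((⟨0, 0, 1, 2, 0⟩ : WeierstrassCurve ℤ).map (Int.castRingHom ℚ)) K p)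
      n' → 1 ≤ M' → (M' : ℕ∞) ≤ Literature.NumberTheory.EllipticCurves.Zhang2014.levelIndex ((⟨0, 0, 1, 2, 0⟩ : WeierstrassCurve ℤ).map (Int.castRingHom ℚ)) p n' →
      d'.kolyvaginClass hp.out M' ≠ 0 → n.primeFactors.card ≤ n'.primeFactors.card) ∧
      ((n.primeFactors.card + 1 = ((⟨0, 0, 1, 2, 0⟩ : WeierstrassCurve ℤ).map (Int.castRingHom ℚ)).mordellWeilRank ∧ (((⟨0, 0, 1, 2, 0⟩ : WeierstrassCurve ℤ).map (Int.castRingHom ℚ)).quadraticTwist (NumberField.discr K :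
      ℚ)).mordellWeilRank < ((⟨0, 0, 1, 2, 0⟩ : WeierstrassCurve ℤ).map (Int.castRingHom ℚ)).mordellWeilRank) ∨ (n.primeFactors.card = ((⟨0, 0, 1, 2, 0⟩ : WeierstrassCurve ℤ).map (Int.castRingHom ℚ)).mordellWeilRank ∧
      (((⟨0, 0, 1, 2, 0⟩ : WeierstrassCurve ℤ).map (Int.castRingHom ℚ)).quadraticTwist (NumberField.discr K : ℚ)).mordellWeilRank = ((⟨0, 0, 1, 2, 0⟩ : WeierstrassCurve ℤ).map (Int.castRingHom ℚ)).mordellWeilRank + 1)) := by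
  haveI := isElliptic
  haveI := isGloballyMinimal
  haveI : NeZero (((⟨0, 0, 1, 2, 0⟩ : WeierstrassCurve ℤ).map (Int.castRingHom ℚ)).conductorNorm ℤ) := neZero_conductorNorm_of_isElliptic _
  intro Dt β ι d hne
  haveI := Fact.mk (by norm_num : Nat.Prime 5)
  exact kolyvaginDepthSupply_clause_secondSign_of_intModel_certificate intModel h372 not_hasCM
    one_le_rank 5 (by norm_num) (by decide +kernel) (np := 7) card_5 (by decide +kernel)
    hasSurjectiveModNGaloisRep_pow_5 K hK hD (by norm_num) (by norm_num) (by norm_num)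
    twistModel_neg68 two_le_rank_twist_neg68 heegner_neg68 29 (by norm_num) (by norm_num)
    (by decide +kernel) (by norm_num) (by norm_num) (by norm_num) (by norm_num) (n := 20) card_29
    (by norm_num) (Δ₀ := -539) (by decide +kernel) (B := 11) (by decide +kernel) (by decide +kernel)
    (fun _ _ ↦ Or.inl (by norm_num)) hKoly Dt β ι d hne

/-- **The crux `KolyvaginDepthSupply` RESTRICTED TO `77a1` is decided by one computation on the SECOND
sign — no Kolyvagin structure theorem.** For `E = 77a1` (rank one), any imaginary quadratic `K` with
`d_K = -131` (Heegner; `E^{(-131)}` has rank two, kernel-certified), any frame `(Dt, β, ι)` and any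
Kolyvagin–Heegner datum `d` of conductor `29`, granted (γ) = `GrossLMS1991.prop37_2_frobeniusCongruence`
and Kolyvagin's Theorem A `kolyvagin (N_E) E K` (a non-torsion Heegner point gives `rank_ℤ E(K) = 1`):
`c_1(29) ≠ 0` ⇒ the clause of `KolyvaginDepthSupply` at `E`, VERBATIM (witnesses `p = 5`, this `K`, the
minimal non-zero class of the system; the disjunct `ν = rank_ℤ E(ℚ) = 1 ∧ rank_ℤ E^{(d_K)}(ℚ) = 2`).
Side conditions all kernel theorems of `…RowsSecondSign6`. CONDITIONAL on (γ), Kolyvagin's Thm. A and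
the bit; per-curve; BSD is not proved by it. [cite: Kolyvagin1991MathAnn, Thm. 2.3 and §2 Thm. 4]
[cite: Kolyvagin1990, Thm. A] [cite: GrossLMS1991, Thm. 1.3, Prop. 3.7 (2), §4] -/
theorem kolyvaginDepthSupply_clause_secondSign_neg131
    (h372 : GrossLMS1991.prop37_2_frobeniusCongruence)
    (K : Type) [Field K] [NumberField K] (hK : IsImaginaryQuadratic K)
    (hD : NumberField.discr K = -131)
    (hKoly : haveI := isElliptic;
      haveI : NeZero (((⟨0, 0, 1, 2, 0⟩ : WeierstrassCurve ℤ).map (Int.castRingHom ℚ)).conductorNorm ℤ) := neZero_conductorNorm_of_isElliptic _;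
      kolyvagin (((⟨0, 0, 1, 2, 0⟩ : WeierstrassCurve ℤ).map (Int.castRingHom ℚ)).conductorNorm ℤ) ((⟨0, 0, 1, 2, 0⟩ : WeierstrassCurve ℤ).map (Int.castRingHom ℚ)) K) :
    haveI := isElliptic;
    haveI := isGloballyMinimal;
    haveI : NeZero (((⟨0, 0, 1, 2, 0⟩ : WeierstrassCurve ℤ).map (Int.castRingHom ℚ)).conductorNorm ℤ) := neZero_conductorNorm_of_isElliptic _;
    ∀ (Dt : ModularParametrizationData ((⟨0, 0, 1, 2, 0⟩ : WeierstrassCurve ℤ).map (Int.castRingHom ℚ)) (((⟨0, 0, 1, 2, 0⟩ : WeierstrassCurve ℤ).map (Int.castRingHom ℚ)).conductorNorm ℤ)) (β : ℤ) (ι : K →+* ℂ)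
      (d : KolyvaginHeegnerData Dt β ι 29),
    d.kolyvaginClass (p := 5) (by norm_num) 1 ≠ 0 →
    ∃ (p : ℕ) (hp : Fact p.Prime), 5 ≤ p ∧ ((⟨0, 0, 1, 2, 0⟩ : WeierstrassCurve ℤ).map (Int.castRingHom ℚ)).HasGoodReductionAtPrime p ∧ ¬ (p : ℤ) ∣
      ((⟨0, 0, 1, 2, 0⟩ : WeierstrassCurve ℤ).map (Int.castRingHom ℚ)).frobeniusTrace p ∧ ((⟨0, 0, 1, 2, 0⟩ : WeierstrassCurve ℤ).map (Int.castRingHom ℚ)).HasSurjectiveModNGaloisRep p ∧ ∃ (K : Type) (_ : Field K) (_ :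
      NumberField K), Literature.NumberTheory.EllipticCurves.IsImaginaryQuadratic K ∧
      NumberField.discr K ≠ -3 ∧ NumberField.discr K ≠ -4 ∧ ¬ ((p : ℤ) ∣ NumberField.discr K) ∧ ¬ (p
      ∣ ((⟨0, 0, 1, 2, 0⟩ : WeierstrassCurve ℤ).map (Int.castRingHom ℚ)).conductorNorm ℤ) ∧ ∃ (_ : NeZero (((⟨0, 0, 1, 2, 0⟩ : WeierstrassCurve ℤ).map (Int.castRingHom ℚ)).conductorNorm ℤ)),
      Literature.NumberTheory.EllipticCurves.SatisfiesHeegnerHypothesis (((⟨0, 0, 1, 2, 0⟩ : WeierstrassCurve ℤ).map (Int.castRingHom ℚ)).conductorNorm ℤ) K ∧ ∃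
      (Dt : Literature.NumberTheory.EllipticCurves.ModularForms.ModularParametrizationData ((⟨0, 0, 1, 2, 0⟩ : WeierstrassCurve ℤ).map (Int.castRingHom ℚ))
      (((⟨0, 0, 1, 2, 0⟩ : WeierstrassCurve ℤ).map (Int.castRingHom ℚ)).conductorNorm ℤ)) (β : ℤ) (ι : K →+* ℂ) (n : ℕ) (d :
      Literature.NumberTheory.EllipticCurves.KolyvaginHeegnerData Dt β ι n) (M : ℕ),
      Literature.NumberTheory.EllipticCurves.KolyvaginDescent.KolSupp
      (Literature.NumberTheory.EllipticCurves.Zhang2014.IsKolyvaginPrime (((⟨0, 0, 1, 2, 0⟩ : WeierstrassCurve ℤ).map (Int.castRingHom ℚ)).conductorNorm ℤ) ((⟨0, 0, 1, 2, 0⟩ : WeierstrassCurve ℤ).map (Int.castRingHom ℚ)) K p)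
      n ∧ 1 ≤ M ∧ (M : ℕ∞) ≤ Literature.NumberTheory.EllipticCurves.Zhang2014.levelIndex ((⟨0, 0, 1, 2, 0⟩ : WeierstrassCurve ℤ).map (Int.castRingHom ℚ)) p n ∧
      d.kolyvaginClass hp.out M ≠ 0 ∧ (∀ (n' : ℕ) (d' :
      Literature.NumberTheory.EllipticCurves.KolyvaginHeegnerData Dt β ι n') (M' : ℕ),
      Literature.NumberTheory.EllipticCurves.KolyvaginDescent.KolSupp
      (Literature.NumberTheory.EllipticCurves.Zhang2014.IsKolyvaginPrime (((⟨0, 0, 1, 2, 0⟩ : WeierstrassCurve ℤ).map (Int.castRingHom ℚ)).conductorNorm ℤ) ((⟨0, 0, 1, 2, 0⟩ : WeierstrassCurve ℤ).map (Int.castRingHom ℚ)) K p)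
      n' → 1 ≤ M' → (M' : ℕ∞) ≤ Literature.NumberTheory.EllipticCurves.Zhang2014.levelIndex ((⟨0, 0, 1, 2, 0⟩ : WeierstrassCurve ℤ).map (Int.castRingHom ℚ)) p n' →
      d'.kolyvaginClass hp.out M' ≠ 0 → n.primeFactors.card ≤ n'.primeFactors.card) ∧
      ((n.primeFactors.card + 1 = ((⟨0, 0, 1, 2, 0⟩ : WeierstrassCurve ℤ).map (Int.castRingHom ℚ)).mordellWeilRank ∧ (((⟨0, 0, 1, 2, 0⟩ : WeierstrassCurve ℤ).map (Int.castRingHom ℚ)).quadraticTwist (NumberField.discr K :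
      ℚ)).mordellWeilRank < ((⟨0, 0, 1, 2, 0⟩ : WeierstrassCurve ℤ).map (Int.castRingHom ℚ)).mordellWeilRank) ∨ (n.primeFactors.card = ((⟨0, 0, 1, 2, 0⟩ : WeierstrassCurve ℤ).map (Int.castRingHom ℚ)).mordellWeilRank ∧
      (((⟨0, 0, 1, 2, 0⟩ : WeierstrassCurve ℤ).map (Int.castRingHom ℚ)).quadraticTwist (NumberField.discr K : ℚ)).mordellWeilRank = ((⟨0, 0, 1, 2, 0⟩ : WeierstrassCurve ℤ).map (Int.castRingHom ℚ)).mordellWeilRank + 1)) := by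
  haveI := isElliptic
  haveI := isGloballyMinimal
  haveI : NeZero (((⟨0, 0, 1, 2, 0⟩ : WeierstrassCurve ℤ).map (Int.castRingHom ℚ)).conductorNorm ℤ) := neZero_conductorNorm_of_isElliptic _
  intro Dt β ι d hne
  haveI := Fact.mk (by norm_num : Nat.Prime 5)
  exact kolyvaginDepthSupply_clause_secondSign_of_intModel_certificate intModel h372 not_hasCM
    one_le_rank 5 (by norm_num) (by decide +kernel) (np := 7) card_5 (by decide +kernel)
    hasSurjectiveModNGaloisRep_pow_5 K hK hD (by norm_num) (by norm_num) (by norm_num)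
    twistModel_neg131 two_le_rank_twist_neg131 heegner_neg131 29 (by norm_num) (by norm_num)
    (by decide +kernel) (by norm_num) (by norm_num) (by norm_num) (by norm_num) (n := 20) card_29
    (by norm_num) (Δ₀ := -539) (by decide +kernel) (B := 11) (by decide +kernel) (by decide +kernel)
    (fun _ _ ↦ Or.inl (by norm_num)) hKoly Dt β ι d hne

end C77a1

end SecondSign

end Summit.BirchSwinnertonDyer.BirchSwinnertonDyer.Theorems.KolyvaginDepthDoor

end
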